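import Mathlib.LinearAlgebra.Matrix.NonsingularInverse
import Literature.Geometry.Lorentzian.InitialData
import Literature.Geometry.Lorentzian.Volume
import Literature.Geometry.Lorentzian.WeightedNorms
import Literature.Geometry.Lorentzian.KerrData
import HarnessLib

/-!
# Killing spinor initial data: the KSID residuals, approximate Killing spinors and the
# non-Kerrness (Killing-spinor data defect) of an initial data set

Topic `Literature/Geometry/Lorentzian`; definition request `defn-KillingSpinorDataDefect` (route
`FinalStateConjecture/KerrnessPropagates`, item `KillingSpinorCoercivity`).

A vacuum spacetime is locally isometric to Kerr iff (under mild non-degeneracy and asymptotic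
conditions) it carries a valence-2 Killing spinor `∇_{A'(A} κ_{BC)} = 0` whose associated Killing
vector is real (Bäckdahl–Valiente Kroon 2010, Thm. 6). The existence of a Killing spinor on the
development of vacuum data `(S, h, K)` is equivalent to three equations intrinsic to `S`, the
**Killing spinor initial data (KSID) equations** (García-Parrado–Valiente Kroon 2008, Prop. 6;
Bäckdahl–Valiente Kroon 2010, Thm. 9, (kspd1)–(kspd3)):
`ξ_ABCD ≡ ∇_(AB κ_CD) = 0` (the *spatial Killing spinor equation*), `Ψ_(ABC^F κ_D)F = 0` and
`3 κ_(A^E ∇_B^F Ψ_CD)EF + Ψ_(ABC^F ξ_D)F = 0`, where `∇_AB` is the Sen connection of the pair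
`(h, K)` and `Ψ = E + iB` the restriction of the Weyl spinor, computable from the data. Composing
the spatial Killing spinor operator with its formal adjoint gives the second-order elliptic
**approximate Killing spinor equation** `L κ = 0` (B–VK 2010, §5, (ApproximateKillingEquation),
Lemma 11), which on suitably asymptotically Schwarzschildean data has a unique solution with the
asymptotics of the Kerr Killing spinor (B–VK 2010, Thm. 25; with an inner boundary and Dirichlet
data, B–VK 2011, Thm. 1); the **non-Kerrness** `I ≡ J + I₁ + I₂ ∈ [0, ∞]` is the sum of the squared
`L²(S, dμ_h)` norms of the three KSID residuals of that solution (B–VK 2010, §9, (functional),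
(I1), (I2), (geometric:invariant)); it is finite (Lemma 27) and vanishes iff the data are (locally)
Kerr data (Thm. 28; B–VK 2011, Thm. 2).

The space-spinor objects have complex-tensor equivalents (`κ_a ≡ σ_a^{AB} κ_AB` is a complex
covector field, totally symmetric valence-4 spinors are complex symmetric trace-free 2-tensors), and
B–VK 2010, App. B ("Tensor expressions") prints every ingredient of `I` in that language. This file
renders those printed tensor expressions as **real definitions** for data `D : InitialDataSet 𝓘(ℝ, E3) U`
on an open subset `U ⊆ E3 = ℝ³` (global chart, trivial spin structure; `T_x U = E3`
definitionally), in components with respect to the coordinate frame `eₐ = EuclideanSpace.single a 1`: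

* Part A (coordinate calculus, prelude conventions): `frame`, the Gram matrix `hLow` and its inverse
  `hUp`, the volume form `volLow = √(det h) [abc]`, the Christoffel symbols `christoffel`
  (`Γ^c_ab = ((∇_{eₐ} e_b))^c` of the prelude's Levi-Civita connection `D.metric.leviCivita`), and
  the covariant derivatives `covD₁`, `covD₂` of (real or complex) covector / covariant 2-tensor
  component fields (`D_a v_b = ∂_a v_b − Γ^c_ab v_c`, `mvfderiv` for `∂`).
* Part B (Gauss–Codazzi): the electric and magnetic parts `weylElectric`, `weylMagnetic` of the
  Weyl tensor of a vacuum development computed from `(h, k)`, and `weyl = E + iB` (`C_ab` of App. B,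
  the tensor equivalent of `Ψ_ABCD`; B–VK 2010, (Weyl:Electric)–(Weyl:Magnetic); tensor form
  Valiente Kroon 2022, (11.37a), (11.6) with (11.35i)).
* Part C (B–VK 2010, App. B, verbatim): the lapse `ζ = D^a κ_a`, the shift `ζ_a`, the spatial
  Killing spinor residual `ζ_ab` (`spatialKillingSpinorResidual`), the approximate Killing spinor
  operator `L` (`approximateKillingSpinorOp`, App. B (elliptictensor)), the two algebraic residuals
  (`firstAlgebraicResidual = (i/√2) ε_cd(a C_b)^d κ^c`, the tensor form of `Ψ_(ABC^F κ_D)F`, and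
  `secondAlgebraicResidual`, the tensor form of `3κ_(A^E ∇_B^F Ψ_CD)EF + Ψ_(ABC^F ξ_D)F` built from
  `Σ_ab` = `weylSenCurl`), the integrands `𝔍, 𝔍₁, 𝔍₂` as Hermitian square norms `hermNormSq`, and
  `nonKerrness D κ = J + I₁ + I₂ ∈ [0, ∞]` (integrals against the Riemannian measure of `h`, file
  `Volume`).
* Part D (the boundary value problem and the defect): `IsApproximateKillingSpinor D κ`
  (`κ` smooth, `L κ = 0`), the Kerr Killing-spinor asymptotics `kerrKillingSpinorSeed m`
  (B–VK 2011, (Asymptotic:kappa); boosted form `boostedKerrKillingSpinorSeed`, B–VK 2010, App. B),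
  `HasKillingSpinorAsymptotics` (`κ − seed ∈ H²_{-1/2}` on the end, Bartnik's weight `δ = −1/2`,
  B–VK 2010, Thm. 25 / B–VK 2011, (Ansatz)), and the **Killing-spinor data defect**
  `InitialDataSet.killingSpinorDataDefect D m bc = ⨅ {I(κ) | L κ = 0, κ has the Kerr asymptotics
  with mass m, bc κ}` with the behaviour `bc` at any inner boundary as an explicit parameter;
  `Kerr.sliceKillingSpinorDataDefect` specialises to data on the Kerr–Schild slab
  `Kerr.slice a r₀` with `m` the ADM mass of the data on the end `Kerr.afEnd a r₀`.

## Conventions (the dictionary to the sources)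

The papers use signature `(+,−,−,−)`, a **negative definite** `h_ab`, the normal `τ^μ` with
`τ_μ τ^μ = 2` and `K_μν = −h_μ^λ h_ν^ρ ∇_λ τ_ρ` (B–VK 2010, §3.1, §6.1: "the unusual coefficients
… come from our normalisation of `τ^μ`"). With `ν` the prelude's future unit normal, `τ = √2 ν`,
so in terms of the prelude's data `(h, k)` (`InitialData`: `h` positive definite,
`k(v, w) = g(∇_v ν, w)`): `h^paper = −h` (`gLow`, inverse `gUp = −hUp`), `K^paper = √2·k`
(`tauK`; checked on the printed Hamiltonian constraint `−2r − K² + K_abK^ab = 0`, §6.1, and on the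
`K`-terms of `ζ_a` against (xi_sen_2)), `ε^paper_abc = ν^μ ε_μabc` = the volume form of `h`
(`volLow`), `D^paper = D` (the Levi-Civita connections of `h` and `−h` agree) and
`C^paper_ab = E_ab + iB_ab` with `E, B` the standard unit-normal electric and magnetic parts
(App. B: pull-backs of `½ τ^γ τ^δ C_αγβδ` and `¼ ε_μνγδ τ^β τ^δ C_αβ^μν`). Part C raises and
lowers indices with `gUp`/`gLow` exactly as printed. The remaining binary conventions — the sign of
`K` (time orientation), the orientation of `ε`, the overall sign of `C` (Riemann sign convention) —
are immaterial: each acts on all residuals by complex conjugation composed with `κ ↦ κ̄` (every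
`ε` comes with a factor `i`; `E` is even and `B` odd in `k`), resp. by an overall sign, so the
integrands `𝔍, 𝔍₁, 𝔍₂`, the zero sets of the residuals and `L`, and the class of Kerr asymptotics
(whose imaginary part is odd in the momentum) are unchanged.

## Design choices and checks

* **Components in the global chart.** On `U : Opens E3` the coordinate frame is global, so every
  abstract-index formula of App. B is a finite sum over `Fin 3`; the only non-algebraic inputs are
  the prelude's `D.h`, `D.k`, `D.metric.leviCivita` (through `christoffel`), `D.metric.ricci` and
  Mathlib's `mvfderiv`. `covD₂` applied to `kLow D` agrees with the prelude's `covDeriv₂ D.k`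
  (`LeviCivita.covDeriv₂_apply` with `ChartCalculus.leviCivita_const`); we use the component form
  uniformly for real and complex fields (`RCLike 𝕜`).
* **`𝔍₁, 𝔍₂` as squared norms.** App. B prints `𝔍₁` and `𝔍₂` expanded into 3 resp. 12 monomials.
  We define them as the Hermitian square norms (`hermNormSq`, `X_ab X̄^ab`) of the tensor
  equivalents `P(C, κ)` and `−3 P(Σ, κ) + P(C, ζ⃗)` of the spinors `Ψ_(ABC^F κ_D)F` and
  `3κ_(A^E Σ_BCD)E + Ψ_(ABC^F ξ_D)F` (App. B prints `σσ Ψ_(ABC^F κ_D)F = (i/√2) ε_cd(a C_b)^d κ^c`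
  and `𝔍 = ξ_ABCD ξ̂^ABCD = ζ_ab ζ̄^ab`; `κ_(A^F Σ_BCD)F = −Σ_(ABC^F κ_D)F`). This is the defining
  form of (I1)–(I2) (§9) and is manifestly `≥ 0`; it agrees identically with the printed expansion
  of `𝔍₁`, and with that of `𝔍₂` once the sign of its monomial `½ C^bc C̄_bc ζ^a ζ̄_a` is read as
  `−½` (a misprint in App. B of arXiv:1005.0743v3: with `+½` the expansion is not a square;
  numerical check of both identities on random tensors recorded with the definition request).
* **Asymptotics in coordinate components.** (Asymptotic:kappa) is read for the coordinate
  covector components `κ_a`: `κ_a = −(√2/3)(1 + 2m/r) x_a + o_∞(r^{-1/2})`. Check: for time-symmetric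
  Schwarzschild data in isotropic coordinates, `h = ψ⁴ δ`, `ψ = 1 + m/2r`, the spatial Killing
  spinor equation `ζ_ab = 0` is the conformal Killing equation (App. B) and `κ_a = ψ⁴ x_a =
  (1 + 2m/r) x_a + O(r⁻¹)` solves it exactly. `o_∞(r^{-1/2})` means `H^∞_{-1/2}` in Bartnik's
  convention (B–VK 2010, §6.2); the solution class of Thm. 25 / B–VK 2011 Thm. 1 is
  `κ − κ̊ ∈ H²_{-1/2}`, which we impose on the end `{R < ‖x‖} ⊆ U` with the tree's
  `weightedSobolevSeminorm` (file `WeightedNorms`; its exponent `δ = −δ_B − 3/2 = −1` for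
  Bartnik's `δ_B = −1/2`; the coordinate weight `1 + ‖x‖` and Lebesgue measure replace Bartnik's
  `σ` and `dμ_h`, an equivalent seminorm on an asymptotically flat end).
* **The inner boundary.** B–VK 2011 pose `L κ = 0` on `S ≈ ℝ³ ∖ B₁` with Dirichlet datum the
  `n_AB`-Killing spinor candidate `κ̆'_AB` (their (CandidateALT): a Weyl-concomitant with branch
  choices `ψ^{-1/3} Ξ^{-1/2}` under their Assumption 1). On an *open* `U` the boundary is not part
  of the manifold, and the candidate needs notions not in the tree; the boundary behaviour is
  therefore the explicit parameter `bc` of `killingSpinorDataDefect` (`fun _ ↦ True` gives the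
  infimum of `I` over all approximate Killing spinors with the Kerr asymptotics — a lower bound of
  the B–VK invariant; the Dirichlet condition of B–VK 2011 is `bc κ :=` "`κ` extends continuously
  to `∂U` with value `κ̆'`"). `-- TODO(general form): the candidate κ̆' (B–VK 2011, Def. 1,
  (CandidateALT)) and the two-ended version (B–VK 2010, §6.1).`
* **Infimum, not a choice.** Under the hypotheses of B–VK 2010 Thm. 25 / 2011 Thm. 1 the solution is
  unique and the infimum is attained by it; outside them `⨅ ∅ = ⊤` documents "undefined".
* **Not vendored here (D-0026; statements need notions absent from the tree):** B–VK 2010 Lemma 11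
  (ellipticity of `L`), Thm. 25 / Cor. 26 / Lemma 27 (existence, finiteness; two asymptotically
  Euclidean ends), Thm. 28 and B–VK 2011 Thms. 1–2 (`I = 0` iff the development is locally isometric
  to Kerr: needs the Dirichlet candidate and developments, cf. `CauchyDevelopment`), GP–VK 2008
  Prop. 6 / B–VK 2010 Thm. 9 (KSID ⇔ Killing spinor on the domain of dependence). No named fact is
  introduced; the three API lemmas at the end are proved.

## References

* T. Bäckdahl, J. A. Valiente Kroon, *On the construction of a geometric invariant measuring the
  deviation from Kerr data*, Ann. Henri Poincaré 11 (2010) 1225–1271, arXiv:1005.0743: §3 (space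
  spinors, conventions), Thm. 9 and §4.3.1 (KSID equations), §5 (approximate Killing spinor
  equation, Lemmas 11–12), §6 (weighted Sobolev spaces, decay), Lemma 16–Thm. 17, Thm. 25, Cor. 26,
  §9 (the invariant, Lemma 27, Thm. 28), App. B (tensor expressions). [BackdahlValientekroon2010]
* T. Bäckdahl, J. A. Valiente Kroon, *The 'non-Kerrness' of domains of outer communication of black
  holes and exteriors of stars*, Proc. R. Soc. A 467 (2011) 1701–1718, arXiv:1010.2421: §4
  ((Asymptotic:kappa), Assumption 1, (CandidateALT), Thm. 1), §5 (Thm. 2). [BackdahlValientekroon2011]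
* A. García-Parrado Gómez-Lobo, J. A. Valiente Kroon, *Killing spinor initial data sets*, J. Geom.
  Phys. 58 (2008) 1186–1202, arXiv:0712.3373: §3 (space spinors, `E_ABCD`, `B_ABCD`), Prop. 6,
  (xi_1)–(xi_2). [GomezloboValientekroon2008]
* J. A. Valiente Kroon, *Conformal Methods in General Relativity*, CUP 2022: §4.2.2 (spatial
  Infeld–van der Waerden symbols), §11.1.2 and (11.35i), (11.37a) (electric/magnetic parts from
  data). [Kroon2022]
-/

open Manifold Bundle TopologicalSpace MeasureTheory
open scoped ContDiff Topology

noncomputable section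

namespace Literature.Geometry.Lorentzian

variable {U : Opens E3}

namespace KillingSpinorData

/-! ### Part A. Coordinate calculus on an open subset of `E3` -/

/-- The coordinate frame `eₐ = ∂_a` of `E3` (Mathlib's standard basis vector
`EuclideanSpace.single a 1`), a tangent vector at every point of `U` (`T_x U = E3`). [folklore] -/
def frame (a : Fin 3) : E3 :=
  EuclideanSpace.single a 1

variable (D : InitialDataSet 𝓘(ℝ, E3) U)

/-- The Gram matrix `h_ab(x) = h_x(eₐ, e_b)` of the metric of the data in the coordinate frame
(positive definite). Lee 2018, (2.12). [folklore] -/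
def hLow (x : U) : Matrix (Fin 3) (Fin 3) ℝ :=
  Matrix.of fun a b ↦ D.h.inner x (frame a) (frame b)

/-- The inverse metric `h^{ab}(x)` (matrix inverse of the Gram matrix; `h` is positive definite, so
this is the honest inverse). O'Neill 1983, Ch. 3, p. 60. [folklore] -/
def hUp (x : U) : Matrix (Fin 3) (Fin 3) ℝ :=
  (hLow D x)⁻¹

/-- The Levi-Civita permutation symbol `[abc] ∈ {0, ±1}` (determinant of the matrix with rows
`eₐ, e_b, e_c`; `[012] = 1`). [folklore] -/
def leviCivitaSymbol (a b c : Fin 3) : ℝ :=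
  Matrix.det (Matrix.of ![(Pi.single a 1 : Fin 3 → ℝ), Pi.single b 1, Pi.single c 1])

/-- The components `ε_abc(x) = √(det h(x)) [abc]` of the Riemannian volume form of `h` in the
coordinate frame, for the standard orientation of `E3` (the opposite orientation changes every
residual below by complex conjugation only, see the module docstring). It is the pull-back
`ν^μ ε_μabc` of B–VK 2010, App. B. Lee 2018, Prop. 2.41. [folklore] -/
def volLow (x : U) (a b c : Fin 3) : ℝ :=
  Real.sqrt (hLow D x).det * leviCivitaSymbol a b c

/-- The components `k_ab(x) = k_x(eₐ, e_b)` of the second fundamental form of the data (prelude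
convention: future unit normal, `k(v, w) = g(∇_v ν, w)`), as a real `2`-tensor component field on
`U`. Bartnik–Isenberg 2004, §2. [folklore] -/
def kLow (x : U) (a b : Fin 3) : ℝ :=
  D.k x (frame a) (frame b)

variable [D.metric.HasLeviCivita]

/-- The Christoffel symbols `Γ^c_ab(x)` of `h` in the global chart: the `c`-th coordinate of
`∇_{eₐ} e_b (x)` for the prelude's Levi-Civita connection applied to the constant field `e_b`
(Mathlib's argument order `cov Y x X₀ = ∇_{X₀} Y`); equal to `½ h^{cd}(∂_a h_bd + ∂_b h_ad − ∂_d h_ab)`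
by `OpensChart.leviCivita_const`. O'Neill 1983, Ch. 3, Prop. 3.13. [cite: ONeill1983, Ch. 3, Prop. 3.13] -/
def christoffel (x : U) (a b c : Fin 3) : ℝ :=
  (show E3 from D.metric.leviCivita (fun _ : U ↦ (frame b : E3)) x (frame a)) c

/-- The components `Ric_ab(x) = Ric_x(eₐ, e_b)` of the Ricci tensor of `h` (prelude `ricci`,
convention `Ric(X, Y) = tr (v ↦ R(v, X) Y)`, positive on round spheres). O'Neill 1983, Ch. 3,
Lemma 3.52. [cite: ONeill1983, Ch. 3, Lemma 3.52] -/
def ricLow (x : U) (a b : Fin 3) : ℝ :=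
  D.metric.ricci x (frame a) (frame b)

variable {𝕜 : Type*} [RCLike 𝕜]

/-- The coordinate derivative `∂_a v_b (x)` of a (real or complex) covector component field
`v : U → (Fin 3 → 𝕜)` (Mathlib's `mvfderiv` of the vector-valued function `v` in the direction
`eₐ`, component `b`). [folklore] -/
def pd₁ (v : U → Fin 3 → 𝕜) (x : U) (a b : Fin 3) : 𝕜 :=
  mvfderiv 𝓘(ℝ, E3) v x (frame a) b

/-- The covariant derivative `D_a v_b = ∂_a v_b − Γ^c_ab v_c` of a covector component field with
respect to the Levi-Civita connection of `h` (for complex `v`: real and imaginary parts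
separately). O'Neill 1983, Ch. 3, Prop. 3.13 and Prop. 3.18. [cite: ONeill1983, Ch. 3, Prop. 3.18] -/
def covD₁ (v : U → Fin 3 → 𝕜) (x : U) (a b : Fin 3) : 𝕜 :=
  pd₁ v x a b - ∑ c, (christoffel D x a b c : 𝕜) * v x c

/-- The coordinate derivative `∂_c T_ab (x)` of a covariant `2`-tensor component field
`T : U → (Fin 3 → Fin 3 → 𝕜)`. [folklore] -/
def pd₂ (T : U → Fin 3 → Fin 3 → 𝕜) (x : U) (c a b : Fin 3) : 𝕜 :=
  mvfderiv 𝓘(ℝ, E3) T x (frame c) a b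

/-- The covariant derivative `D_c T_ab = ∂_c T_ab − Γ^e_ca T_eb − Γ^e_cb T_ae` of a covariant
`2`-tensor component field with respect to the Levi-Civita connection of `h`. O'Neill 1983,
Ch. 3, Prop. 3.18; Lee 2018, Prop. 4.16. [cite: ONeill1983, Ch. 3, Prop. 3.18] -/
def covD₂ (T : U → Fin 3 → Fin 3 → 𝕜) (x : U) (c a b : Fin 3) : 𝕜 :=
  pd₂ T x c a b - ∑ e, (christoffel D x c a e : 𝕜) * T x e b
    - ∑ e, (christoffel D x c b e : 𝕜) * T x a e

/-! ### Part B. The electric and magnetic parts of the Weyl tensor from the data -/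

/-- The **electric part of the Weyl tensor** of the vacuum development along the slice, computed
from the data by the Gauss equation: the `h`-trace-free part of
`Ric_ab + (tr_h k) k_ab − k_ac h^{cd} k_db` (on solutions of the vacuum Hamiltonian constraint the
trace already vanishes). It is the tensor equivalent of B–VK's totally symmetric
`E_ABCD = −r_(ABCD) + ½ Ω_(AB^PQ Ω_CD)PQ − ⅙ Ω_ABCD K` (B–VK 2010, (Weyl:Electric); GP–VK 2008, §3),
up to the overall sign fixed by the Riemann convention (immaterial here, module docstring); tensor
form Valiente Kroon 2022, (11.37a) with `Ω = 1`, `L_ab = 0`. [cite: Kroon2022, (11.37a)] -/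
def weylElectric (x : U) (a b : Fin 3) : ℝ :=
  let trk : ℝ := ∑ c, ∑ d, hUp D x c d * kLow D x c d
  let M : Fin 3 → Fin 3 → ℝ := fun a b ↦
    ricLow D x a b + trk * kLow D x a b - ∑ c, ∑ d, kLow D x a c * hUp D x c d * kLow D x d b
  M a b - (1 / 3 : ℝ) * (∑ c, ∑ d, hUp D x c d * M c d) * hLow D x a b

/-- The **magnetic part of the Weyl tensor** of the vacuum development along the slice, computed
from the data by the Codazzi equation: the symmetrised curl `B_ab = ε_(a|^{cd} D_c k_d|b)`
(`ε_a^{cd} = ε_ac'd' h^{c'c} h^{d'd}`; it is trace-free, and already symmetric on solutions of the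
momentum constraint). Tensor equivalent of B–VK's totally symmetric `B_ABCD = −i D^Q_(A Ω_BCD)Q`
(B–VK 2010, (Weyl:Magnetic); GP–VK 2008, (B_ABCD)) up to the orientation sign (immaterial); tensor
form Valiente Kroon 2022, (11.6) with the Codazzi equation (11.35i), `Ω = 1`, `L_a = 0`. [cite: Kroon2022, (11.6) and (11.35i)] -/
def weylMagnetic (x : U) (a b : Fin 3) : ℝ :=
  let curl : Fin 3 → Fin 3 → ℝ := fun a b ↦
    ∑ c', ∑ d', ∑ c, ∑ d,
      volLow D x a c' d' * hUp D x c' c * hUp D x d' d * covD₂ D (kLow D) x c d b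
  (1 / 2 : ℝ) * (curl a b + curl b a)

/-- The complex symmetric trace-free tensor `C_ab = E_ab + i B_ab` of B–VK 2010, App. B: the
tensor equivalent `σ_a^{AB} σ_b^{CD} Ψ_ABCD` of the restriction `Ψ_ABCD = E_ABCD + i B_ABCD` of
the Weyl spinor to the slice (B–VK 2010, §3.6), as a complex `2`-tensor component field on `U`. [cite: BackdahlValientekroon2010, App. B] -/
def weyl (x : U) (a b : Fin 3) : ℂ :=
  (weylElectric D x a b : ℂ) + Complex.I * (weylMagnetic D x a b : ℂ)

/-! ### Part C. The KSID residuals in the conventions of B–VK 2010, App. B -/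

omit [D.metric.HasLeviCivita] in
/-- The papers' negative definite `3`-metric `h^paper_ab = −h_ab` (signature `(+,−,−,−)`
conventions, B–VK 2010, §1 "General notation and conventions"). [cite: BackdahlValientekroon2010, §1] -/
def gLow (x : U) (a b : Fin 3) : ℝ :=
  -hLow D x a b

omit [D.metric.HasLeviCivita] in
/-- The inverse `h_paper^{ab} = −h^{ab}` of the papers' negative definite `3`-metric; Part C
raises indices with it, as printed. B–VK 2010, §1. [cite: BackdahlValientekroon2010, §1] -/
def gUp (x : U) (a b : Fin 3) : ℝ :=
  -hUp D x a b

omit [D.metric.HasLeviCivita] in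
/-- The papers' second fundamental form `K_ab = √2 · k_ab`: B–VK normalise the normal by
`τ_μ τ^μ = 2`, i.e. `τ = √2 ν`, and `K_μν = −h_μ^λ h_ν^ρ ∇_λ τ_ρ` (B–VK 2010, §3.1; §6.1: "the
unusual coefficients [of `−2r − K² + K_ab K^ab = 0`] come from our normalisation of `τ^μ`"). The
sign (time orientation) is immaterial (module docstring). [cite: BackdahlValientekroon2010, §3.1 and §6.1] -/
def tauK (x : U) (a b : Fin 3) : ℝ :=
  Real.sqrt 2 * kLow D x a b

/-- The **lapse candidate** `ζ = ξ ≡ ∇^PQ κ_PQ = D^a κ_a` of a complex covector field `κ_a`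
(the tensor equivalent of `κ_AB`). B–VK 2010, (xi_sen_1) and App. B (`ζ = D^a κ_a`). [cite: BackdahlValientekroon2010, App. B] -/
def lapse (κ : U → Fin 3 → ℂ) (x : U) : ℂ :=
  ∑ a, ∑ b, (gUp D x a b : ℂ) * covD₁ D κ x b a

/-- The **shift candidate** `ζ_a ≡ σ_a^{AB} ξ_AB`, `ξ_AB = (3/2) ∇_(A^D κ_B)D`:
`ζ_a = (3/(2√2)) i ε_abc D^c κ^b − ¾ K_ab κ^b + ¾ K_b^b κ_a` (indices raised with `h_paper^{ab}`,
`K = tauK`, `ε = volLow`). For a Killing spinor, `(ζ, ζ_a)` are the Killing initial data (lapse,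
shift) of the associated Killing vector. B–VK 2010, (xi_sen_2) and App. B. [cite: BackdahlValientekroon2010, App. B] -/
def shift (κ : U → Fin 3 → ℂ) (x : U) (a : Fin 3) : ℂ :=
  let Dκ : Fin 3 → Fin 3 → ℂ := covD₁ D κ x
  let κU : Fin 3 → ℂ := fun c ↦ ∑ e, (gUp D x c e : ℂ) * κ x e
  let DκUU : Fin 3 → Fin 3 → ℂ := fun c b ↦
    ∑ c', ∑ b', (gUp D x c c' : ℂ) * (gUp D x b b' : ℂ) * Dκ c' b'
  let trK : ℝ := ∑ b, ∑ c, gUp D x b c * tauK D x b c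
  ((3 / (2 * Real.sqrt 2) : ℝ) : ℂ) * Complex.I * (∑ b, ∑ c, (volLow D x a b c : ℂ) * DκUU c b)
    - (3 / 4 : ℂ) * (∑ b, (tauK D x a b : ℂ) * κU b)
    + (3 / 4 : ℂ) * (trK : ℂ) * κ x a

/-- The **spatial Killing spinor residual** `ζ_ab ≡ σ_a^{AB} σ_b^{CD} ξ_ABCD`,
`ξ_ABCD = ∇_(AB κ_CD)`:
`ζ_ab = D_(a κ_b) − ⅓ h_ab D^c κ_c − (i/√2) ε_cd(a K_b)^d κ^c` (papers' `h_ab = gLow`, `K = tauK`,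
indices raised with `gUp`). The spatial Killing spinor equation (B–VK 2010, (kspd1),
(SpatialKillingSpinorEquation); GP–VK 2008, (killingspinor_a)) is `ζ_ab = 0`; for `k = 0` it is the
conformal Killing equation. B–VK 2010, App. B. [cite: BackdahlValientekroon2010, App. B] -/
def spatialKillingSpinorResidual (κ : U → Fin 3 → ℂ) (x : U) (a b : Fin 3) : ℂ :=
  let Dκ : Fin 3 → Fin 3 → ℂ := covD₁ D κ x
  let κU : Fin 3 → ℂ := fun c ↦ ∑ e, (gUp D x c e : ℂ) * κ x e
  let KM : Fin 3 → Fin 3 → ℝ := fun b d ↦ ∑ e, tauK D x b e * gUp D x e d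
  (1 / 2 : ℂ) * (Dκ a b + Dκ b a) - (1 / 3 : ℂ) * (gLow D x a b : ℂ) * lapse D κ x
    - (Complex.I / (Real.sqrt 2 : ℂ)) * (1 / 2 : ℂ) *
        ∑ c, ∑ d, ((volLow D x c d a * KM b d + volLow D x c d b * KM a d : ℝ) : ℂ) * κU c

/-- The **approximate Killing spinor operator** `L = Φ* ∘ Φ` (B–VK 2010, §5.1,
(ApproximateKillingEquation); formally self-adjoint and elliptic, Lemma 11; Euler–Lagrange operator
of `J`, Lemma 12) in its tensor form `(L κ)_a = D^b ζ_ab − (i/√2) ε_acd K^{bc} ζ_b^d`,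
B–VK 2010, App. B, (elliptictensor). [cite: BackdahlValientekroon2010, App. B (elliptictensor)] -/
def approximateKillingSpinorOp (κ : U → Fin 3 → ℂ) (x : U) (a : Fin 3) : ℂ :=
  let ζ : U → Fin 3 → Fin 3 → ℂ := fun y ↦ spatialKillingSpinorResidual D κ y
  let KUU : Fin 3 → Fin 3 → ℝ := fun b c ↦
    ∑ b', ∑ c', gUp D x b b' * gUp D x c c' * tauK D x b' c'
  let ζM : Fin 3 → Fin 3 → ℂ := fun b d ↦ ∑ e, ζ x b e * (gUp D x e d : ℂ)
  (∑ b, ∑ b', (gUp D x b b' : ℂ) * covD₂ D ζ x b' a b)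
    - (Complex.I / (Real.sqrt 2 : ℂ)) *
        ∑ b, ∑ c, ∑ d, (volLow D x a c d : ℂ) * (KUU b c : ℂ) * ζM b d

/-- The **algebraic product** `P(X, v)_ab = (i/√2) ε_cd(a X_b)^d v^c` of a complex symmetric
trace-free `2`-tensor `X_ab` and a complex vector `v^c` (upper index): the tensor equivalent
`σ_a^{AB} σ_b^{CD} X_(ABC^F v_D)F` of the symmetrised contraction of a totally symmetric valence-`4`
and a symmetric valence-`2` spinor (B–VK 2010, App. B, the display
`σσ Ψ_(ABC^F κ_D)F = (1/√2) i ε_cd(a C_b)^d κ^c`). [cite: BackdahlValientekroon2010, App. B] -/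
def algebraicProduct (x : U) (X : Fin 3 → Fin 3 → ℂ) (v : Fin 3 → ℂ) (a b : Fin 3) : ℂ :=
  let XM : Fin 3 → Fin 3 → ℂ := fun b d ↦ ∑ e, X b e * (gUp D x e d : ℂ)
  (Complex.I / (Real.sqrt 2 : ℂ)) * (1 / 2 : ℂ) *
    ∑ c, ∑ d, ((volLow D x c d a : ℂ) * XM b d + (volLow D x c d b : ℂ) * XM a d) * v c

/-- The **first algebraic KSID residual**, the tensor equivalent `(i/√2) ε_cd(a C_b)^d κ^c` of
`Ψ_(ABC^F κ_D)F` (the integrability condition of the Killing spinor equation; B–VK 2010, (kspd2),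
(IntegrabilityCondition) and App. B). [cite: BackdahlValientekroon2010, (kspd2) and App. B] -/
def firstAlgebraicResidual (κ : U → Fin 3 → ℂ) (x : U) (a b : Fin 3) : ℂ :=
  algebraicProduct D x (weyl D x) (fun c ↦ ∑ e, (gUp D x c e : ℂ) * κ x e) a b

/-- The tensor equivalent `Σ_ab` of `Σ_ABCD ≡ ∇_(A^F Ψ_BCD)F` (Sen derivative of the Weyl spinor):
`Σ_ab = (i/√2) ε_df(a D^f C^d_b) + ½ C^{cd} K_cd h_ab + C_ab K^f_f − (3/2) C^c_(a K_b)c`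
(papers' `h_ab = gLow`, `K = tauK`, indices raised with `gUp`, `C = weyl`). B–VK 2010, App. B. [cite: BackdahlValientekroon2010, App. B] -/
def weylSenCurl (x : U) (a b : Fin 3) : ℂ :=
  let C : U → Fin 3 → Fin 3 → ℂ := fun y ↦ weyl D y
  let DCup : Fin 3 → Fin 3 → Fin 3 → ℂ := fun f d b ↦
    ∑ f', ∑ d', (gUp D x f f' : ℂ) * (gUp D x d d' : ℂ) * covD₂ D C x f' d' b
  let CUU : Fin 3 → Fin 3 → ℂ := fun c d ↦
    ∑ c', ∑ d', (gUp D x c c' : ℂ) * (gUp D x d d' : ℂ) * C x c' d'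
  let CM : Fin 3 → Fin 3 → ℂ := fun c a ↦ ∑ e, (gUp D x c e : ℂ) * C x e a
  let trK : ℝ := ∑ e, ∑ f, gUp D x e f * tauK D x e f
  (Complex.I / (Real.sqrt 2 : ℂ)) * (1 / 2 : ℂ) *
      (∑ d, ∑ f, ((volLow D x d f a : ℂ) * DCup f d b + (volLow D x d f b : ℂ) * DCup f d a))
    + (1 / 2 : ℂ) * (∑ c, ∑ d, CUU c d * (tauK D x c d : ℂ)) * (gLow D x a b : ℂ)
    + C x a b * (trK : ℂ)
    - (3 / 2 : ℂ) * (1 / 2 : ℂ) * ∑ c, (CM c a * (tauK D x b c : ℂ) + CM c b * (tauK D x a c : ℂ))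

/-- The **second algebraic KSID residual**, the tensor equivalent `−3 P(Σ, κ) + P(C, ζ⃗)` of
`3 κ_(A^E ∇_B^F Ψ_CD)EF + Ψ_(ABC^F ξ_D)F` (B–VK 2010, (kspd3); `κ_(A^F Σ_BCD)F = −Σ_(ABC^F κ_D)F`,
and `ξ_AB ↦ ζ_a = shift`). [cite: BackdahlValientekroon2010, (kspd3) and App. B] -/
def secondAlgebraicResidual (κ : U → Fin 3 → ℂ) (x : U) (a b : Fin 3) : ℂ :=
  let κU : Fin 3 → ℂ := fun c ↦ ∑ e, (gUp D x c e : ℂ) * κ x e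
  let ζU : Fin 3 → ℂ := fun c ↦ ∑ e, (gUp D x c e : ℂ) * shift D κ x e
  (-3 : ℂ) * algebraicProduct D x (weylSenCurl D x) κU a b + algebraicProduct D x (weyl D x) ζU a b

omit [D.metric.HasLeviCivita] in
/-- The **Hermitian square norm** `X_ab X̄^{ab} = X_ab conj(X_cd) h_paper^{ac} h_paper^{bd}` of a
complex `2`-tensor (two index raisings, so equal to the `h`-norm; real and `≥ 0`): the tensor form
of the pairing `X_ABCD X̂^ABCD` with the Hermitian conjugate, B–VK 2010, §3.4 and App. B
(`𝔍 = ξ_ABCD ξ̂^ABCD = ζ_ab ζ̄^ab`). [cite: BackdahlValientekroon2010, §3.4 and App. B] -/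
def hermNormSq (x : U) (X : Fin 3 → Fin 3 → ℂ) : ℝ :=
  (∑ a, ∑ b, ∑ c, ∑ d,
      X a b * (starRingEnd ℂ) (X c d) * (gUp D x a c : ℂ) * (gUp D x b d : ℂ)).re

/-- The functional `J = ∫_S ∇_(AB κ_CD) ∇̂^AB κ^CD dμ = ∫_S ζ_ab ζ̄^ab dμ_h ∈ [0, ∞]` — the squared
`L²` norm of the spatial Killing spinor residual, whose Euler–Lagrange equation is `L κ = 0`
(B–VK 2010, (functional), Lemma 12; integrand `𝔍` of App. B), against the Riemannian measure of
`h` (file `Volume`). [cite: BackdahlValientekroon2010, (functional) and Lemma 12] -/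
def functionalJ (κ : U → Fin 3 → ℂ) : ENNReal :=
  ∫⁻ x, ENNReal.ofReal (hermNormSq D x (spatialKillingSpinorResidual D κ x))
    ∂(riemannianMeasure D.h)

/-- The functional `I₁ = ∫_S |Ψ_(ABC^F κ_D)F|² dμ ∈ [0, ∞]` (B–VK 2010, (I1); integrand `𝔍₁` of
App. B, here as the Hermitian square norm of `firstAlgebraicResidual`, which equals the printed
three-term expansion identically). [cite: BackdahlValientekroon2010, (I1) and App. B] -/
def functionalI₁ (κ : U → Fin 3 → ℂ) : ENNReal :=
  ∫⁻ x, ENNReal.ofReal (hermNormSq D x (firstAlgebraicResidual D κ x)) ∂(riemannianMeasure D.h)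

/-- The functional `I₂ = ∫_S |3 κ_(A^E ∇_B^F Ψ_CD)EF + Ψ_(ABC^F ξ_D)F|² dμ ∈ [0, ∞]` (B–VK 2010,
(I2); integrand `𝔍₂` of App. B, here as the Hermitian square norm of `secondAlgebraicResidual` —
the printed twelve-term expansion with the sign of its monomial `½ C^bc C̄_bc ζ^a ζ̄_a` read as
`−½`, see the module docstring). [cite: BackdahlValientekroon2010, (I2) and App. B] -/
def functionalI₂ (κ : U → Fin 3 → ℂ) : ENNReal :=
  ∫⁻ x, ENNReal.ofReal (hermNormSq D x (secondAlgebraicResidual D κ x)) ∂(riemannianMeasure D.h)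

/-- The **non-Kerrness functional** `I(κ) ≡ J + I₁ + I₂ ∈ [0, ∞]` of a complex covector field `κ`
on the data: the sum of the squared `L²(S, dμ_h)` norms of the three Killing-spinor-initial-data
residuals (B–VK 2010, §9, (geometric:invariant); App. B: `I = ∫_S (𝔍 + 𝔍₁ + 𝔍₂) dμ`). B–VK's
geometric invariant is its value at the approximate Killing spinor with Kerr asymptotics
(`InitialDataSet.killingSpinorDataDefect`). [cite: BackdahlValientekroon2010, (geometric:invariant)] -/
def nonKerrness (κ : U → Fin 3 → ℂ) : ENNReal :=
  functionalJ D κ + functionalI₁ D κ + functionalI₂ D κ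

/-! ### Part D. Approximate Killing spinors, Kerr asymptotics and the defect -/

/-- `κ` is an **approximate Killing spinor** of the data: a smooth complex covector field on `U`
solving the approximate Killing spinor equation `L κ = 0` (B–VK 2010, §5.1, Definition after
(adjointPhi); every solution of the spatial Killing spinor equation is one). [cite: BackdahlValientekroon2010, §5.1] -/
def IsApproximateKillingSpinor (κ : U → Fin 3 → ℂ) : Prop :=
  ContMDiff 𝓘(ℝ, E3) 𝓘(ℝ, Fin 3 → ℂ) ∞ κ ∧
    ∀ (x : U) (a : Fin 3), approximateKillingSpinorOp D κ x a = 0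

/-- The **leading asymptotics of the Kerr Killing spinor** on an asymptotically Schwarzschildean end
with ADM mass `m` and vanishing momentum, in asymptotically Cartesian coordinate components:
`κ̊_a(x) = −(√2/3) (1 + 2m/‖x‖) x_a` (B–VK 2011, (Asymptotic:kappa); B–VK 2010, Lemma 16 and App. B
with `p = 0`, `E = m`; the overall sign distinguishes the two ends of B–VK 2010 and is immaterial
for one end). For Schwarzschild data in isotropic coordinates the exact spatial Killing spinor is
`ψ⁴ x_a`, `ψ = 1 + m/2r`, which has these asymptotics. Junk value at `x = 0` (`m/‖0‖ = 0` in
Lean), invisible on an end `{R < ‖x‖}`. [cite: BackdahlValientekroon2011, (Asymptotic:kappa)] -/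
def kerrKillingSpinorSeed (m : ℝ) (x : E3) : Fin 3 → ℂ :=
  fun a ↦ ((-(Real.sqrt 2 / 3) * (1 + 2 * m / ‖x‖) * x a : ℝ) : ℂ)

/-- The **leading asymptotics of the Kerr Killing spinor on a boosted end** with timelike ADM
`4`-momentum `(E, p)`, `m = √(E² − |p|²)`, `n·p = x·p/‖x‖`, in asymptotically Cartesian coordinate
components (upper signs of the source):
`κ̊_a = −(√2 E/3m)(1 + 2E/r) x_a + (2i/3m)(1 + 4E/r − (m² + 2(n·p)²)/(√(m² + (n·p)²) r)) ε_a^{jk} p_j x_k`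
(flat `ε`). Meaningful for `‖p‖ < E` (else `m = 0` and the value is junk) and away from `x = 0`;
reduces to `kerrKillingSpinorSeed E` for `p = 0`, `0 < E`. B–VK 2010, Lemma 16,
(KillingSpinorLeading) and App. B. [cite: BackdahlValientekroon2010, Lemma 16 and App. B] -/
def boostedKerrKillingSpinorSeed (E : ℝ) (p : E3) (x : E3) : Fin 3 → ℂ :=
  let m : ℝ := Real.sqrt (E ^ 2 - ‖p‖ ^ 2)
  let r : ℝ := ‖x‖
  let np : ℝ := inner ℝ x p / r
  let cross : Fin 3 → ℝ := fun a ↦ ∑ b, ∑ c, leviCivitaSymbol a b c * p b * x c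
  fun a ↦
    ((-(Real.sqrt 2 * E / (3 * m)) * (1 + 2 * E / r) * x a : ℝ) : ℂ)
      + ((2 / (3 * m) : ℝ) : ℂ) * Complex.I *
          (((1 + 4 * E / r - (m ^ 2 + 2 * np ^ 2) / (Real.sqrt (m ^ 2 + np ^ 2) * r)) * cross a :
              ℝ) : ℂ)

/-- `κ` **has the Killing-spinor asymptotics `seed`** on the end of `U`: `U` contains a coordinate
end `{R < ‖x‖}` on which `κ − seed ∈ H²_{-1/2}` in Bartnik's weighted Sobolev convention
(`θ = κ − κ̊ ∈ H²_{-1/2}`, the solution class of B–VK 2010, Thm. 25 and B–VK 2011, (Ansatz); in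
the tree's `weightedSobolevSeminorm` the exponent is `δ = −δ_B − 3/2 = −1`). `κ` is extended by
the junk value `0` off `U`, invisible on the open end. [cite: BackdahlValientekroon2010, Thm. 25] -/
def HasKillingSpinorAsymptotics (κ : U → Fin 3 → ℂ) (seed : E3 → Fin 3 → ℂ) : Prop :=
  ∃ R : ℝ, 0 < R ∧ {x : E3 | R < ‖x‖} ⊆ (U : Set E3) ∧
    weightedSobolevSeminorm {x : E3 | R < ‖x‖} 2 (-1) (Function.extend Subtype.val κ 0 - seed) < ⊤

end KillingSpinorData

open KillingSpinorData in
/-- The **Killing-spinor data defect (non-Kerrness) of an initial data set** on an open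
`U ⊆ E3` with one asymptotically flat end of ADM mass `m`:
`I[U, h, k] = ⨅ { J(κ) + I₁(κ) + I₂(κ) | κ smooth, L κ = 0, κ − κ̊_m ∈ H²_{-1/2} on the end, bc κ }
∈ [0, ∞]`, the infimum of the non-Kerrness functional over the approximate Killing spinors with the
Kerr asymptotics and the prescribed behaviour `bc` at the inner boundary (B–VK 2010, §9,
(geometric:invariant) with Thm. 25; B–VK 2011, §5 with Thm. 1, where `bc` is the Dirichlet
condition given by the `n_AB`-Killing spinor candidate (CandidateALT) and the minimiser is unique;
`bc := fun _ ↦ True` gives a lower bound of their invariant; `⨅ ∅ = ⊤`). It vanishes, under the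
hypotheses of B–VK 2011, Thm. 2, iff the data are Kerr data. [cite: BackdahlValientekroon2011, §5 and Thm. 2] -/
def InitialDataSet.killingSpinorDataDefect (D : InitialDataSet 𝓘(ℝ, E3) U) [D.metric.HasLeviCivita]
    (m : ℝ) (bc : (U → Fin 3 → ℂ) → Prop) : ENNReal :=
  ⨅ (κ : U → Fin 3 → ℂ) (_ : IsApproximateKillingSpinor D κ ∧
      HasKillingSpinorAsymptotics κ (kerrKillingSpinorSeed m) ∧ bc κ), nonKerrness D κ

open KillingSpinorData in
/-- The **non-Kerrness of data on the Kerr–Schild slab** `Kerr.slice a r₀ = {max r₀ 0 < r} ⊆ E3`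
(one asymptotically flat end `Kerr.afEnd a r₀`, inner boundary `{r = r₀}`): the Killing-spinor data
defect with `m` the ADM mass of the data `D` read on the end `Kerr.afEnd a r₀` (B–VK 2011, Thm. 1:
"`m` denotes the ADM mass of the asymptotic end") and inner-boundary behaviour `bc`. [cite: BackdahlValientekroon2011, Thm. 1 and §5] -/
def Kerr.sliceKillingSpinorDataDefect (a r₀ : ℝ) (D : InitialDataSet 𝓘(ℝ, E3) (Kerr.slice a r₀))
    [D.metric.HasLeviCivita] (bc : (Kerr.slice a r₀ → Fin 3 → ℂ) → Prop) : ENNReal :=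
  D.killingSpinorDataDefect ((Kerr.afEnd a r₀).admMass D) bc

/-! ### API: the trivial candidate `κ = 0` has vanishing residuals -/

namespace KillingSpinorData

variable (D : InitialDataSet 𝓘(ℝ, E3) U) [D.metric.HasLeviCivita]

/-- The defect is a lower bound of the non-Kerrness functional at every admissible approximate
Killing spinor (definition of the infimum). B–VK 2010, §9. [cite: BackdahlValientekroon2010, §9] -/
theorem killingSpinorDataDefect_le_nonKerrness {m : ℝ} {bc : (U → Fin 3 → ℂ) → Prop}
    {κ : U → Fin 3 → ℂ} (hκ : IsApproximateKillingSpinor D κ)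
    (ha : HasKillingSpinorAsymptotics κ (kerrKillingSpinorSeed m)) (hb : bc κ) :
    D.killingSpinorDataDefect m bc ≤ nonKerrness D κ :=
  iInf₂_le κ ⟨hκ, ha, hb⟩

omit [D.metric.HasLeviCivita] in
/-- The Hermitian square norm of the zero tensor vanishes. [folklore] -/
@[simp]
theorem hermNormSq_zero (x : U) : hermNormSq D x 0 = 0 := by
  simp [hermNormSq]

omit [D.metric.HasLeviCivita] in
/-- The coordinate derivative of the zero covector field vanishes. [folklore] -/
@[simp]
theorem pd₁_zero {𝕜 : Type*} [RCLike 𝕜] (x : U) (a b : Fin 3) :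
    pd₁ (0 : U → Fin 3 → 𝕜) x a b = 0 := by
  simp [pd₁]

omit [D.metric.HasLeviCivita] in
/-- The coordinate derivative of the zero `2`-tensor field vanishes. [folklore] -/
@[simp]
theorem pd₂_zero {𝕜 : Type*} [RCLike 𝕜] (x : U) (c a b : Fin 3) :
    pd₂ (0 : U → Fin 3 → Fin 3 → 𝕜) x c a b = 0 := by
  simp [pd₂]

/-- The covariant derivative of the zero covector field vanishes. O'Neill 1983, Ch. 3, Prop. 3.18.
[folklore] -/
@[simp]
theorem covD₁_zero {𝕜 : Type*} [RCLike 𝕜] (x : U) (a b : Fin 3) :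
    covD₁ D (0 : U → Fin 3 → 𝕜) x a b = 0 := by
  simp [covD₁]

/-- The covariant derivative of the zero `2`-tensor field vanishes. O'Neill 1983, Ch. 3,
Prop. 3.18. [folklore] -/
@[simp]
theorem covD₂_zero {𝕜 : Type*} [RCLike 𝕜] (x : U) (c a b : Fin 3) :
    covD₂ D (0 : U → Fin 3 → Fin 3 → 𝕜) x c a b = 0 := by
  simp [covD₂]

/-- The lapse candidate of `κ = 0` vanishes. B–VK 2010, App. B. [cite: BackdahlValientekroon2010, App. B] -/
@[simp]
theorem lapse_zero (x : U) : lapse D 0 x = 0 := by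
  simp [lapse]

/-- The shift candidate of `κ = 0` vanishes. B–VK 2010, App. B. [cite: BackdahlValientekroon2010, App. B] -/
@[simp]
theorem shift_zero (x : U) (a : Fin 3) : shift D 0 x a = 0 := by
  simp [shift]

/-- The spatial Killing spinor residual of `κ = 0` vanishes (the spatial Killing spinor equation
is linear). B–VK 2010, (kspd1). [cite: BackdahlValientekroon2010, (kspd1)] -/
@[simp]
theorem spatialKillingSpinorResidual_zero (x : U) (a b : Fin 3) :
    spatialKillingSpinorResidual D 0 x a b = 0 := by
  simp [spatialKillingSpinorResidual]

omit [D.metric.HasLeviCivita] in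
/-- The algebraic product with the zero vector vanishes. B–VK 2010, App. B. [cite: BackdahlValientekroon2010, App. B] -/
@[simp]
theorem algebraicProduct_zero (x : U) (X : Fin 3 → Fin 3 → ℂ) (a b : Fin 3) :
    algebraicProduct D x X 0 a b = 0 := by
  simp [algebraicProduct]

/-- `κ = 0` is an approximate Killing spinor of every data set (`L` is linear); the content of
B–VK's construction is in the Kerr asymptotics, which `0` does not have for `m ≠ 0`.
B–VK 2010, §5.1. [cite: BackdahlValientekroon2010, §5.1] -/
theorem isApproximateKillingSpinor_zero : IsApproximateKillingSpinor D 0 := by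
  refine ⟨contMDiff_const, fun x a ↦ ?_⟩
  have hζ : (fun y ↦ spatialKillingSpinorResidual D (0 : U → Fin 3 → ℂ) y) =
      (0 : U → Fin 3 → Fin 3 → ℂ) := by
    funext y a b
    exact spatialKillingSpinorResidual_zero D y a b
  have hζ' : ∀ (y : U) (c a' b' : Fin 3),
      covD₂ D (fun y ↦ spatialKillingSpinorResidual D (0 : U → Fin 3 → ℂ) y) y c a' b' = 0 := by
    intro y c a' b'
    rw [hζ]
    exact covD₂_zero D y c a' b'
  simp [approximateKillingSpinorOp, hζ']

/-- The non-Kerrness functional vanishes at `κ = 0` (all three residuals are linear in `κ`).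
B–VK 2010, §9. [cite: BackdahlValientekroon2010, §9] -/
theorem nonKerrness_zero : nonKerrness D 0 = 0 := by
  have h1 : ∀ x : U, spatialKillingSpinorResidual D (0 : U → Fin 3 → ℂ) x = 0 := by
    intro x; funext a b; exact spatialKillingSpinorResidual_zero D x a b
  have h2 : ∀ x : U, firstAlgebraicResidual D (0 : U → Fin 3 → ℂ) x = 0 := by
    intro x; funext a b; simp [firstAlgebraicResidual, algebraicProduct]
  have h3 : ∀ x : U, secondAlgebraicResidual D (0 : U → Fin 3 → ℂ) x = 0 := by
    intro x; funext a b; simp [secondAlgebraicResidual, algebraicProduct]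
  simp [nonKerrness, functionalJ, functionalI₁, functionalI₂, h1, h2, h3]

end KillingSpinorData

end Literature.Geometry.Lorentzian

end
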